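import Summits.QuantumFields.BalabanUV.Beta.RemainderExplicitSignedLetterIteratedLog

/-!
# EriceRemainderEnclosureHarmonicTruncation — (E29) ONE CURRENCY AT THE BARE END: THE FULL-SUM SIGNED HARMONIC LETTER BOUNDS ALL ITS
# TRUNCATIONS (sharp constant 2)

Cell `pub-balaban`, β-function sub-cell, BINDER row D4 «RemainderConst leaves for Balaban's split» (`HOME/BINDER-OWNERS.md`; owner
lineage `b2b-balaban-beta-an4`; this file by co-owner #2 lineage `b2b-balaban-beta-d4-p2`, generation 31, station (E29) of the
`EriceRemainderEnclosure*` series); β-FLOW TEAM duty (1); FREEZE (0) honoured (def-free module, proof lane; no leaf, no interface, no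
Literature file).  SOURCE OF THE OCCASION: [BalabanJaffe1986] Part III §4 p. 250, (3.73)–(3.76), as SHAPES ONLY — this file is pure
real analysis on letters that are NOT-IN-PRINT (p. 250 prints «β_{n,0} → β₀, β_{n,2} → β₂», no rate, no sign).

THE OCCASION.  Two stations of 2026-08-22 priced the one-loop errors `δ` of the bare-end linearization of (3.74) in two currencies:
the OWNER's (D4-J16) FILE 8 `RemainderCouplingKernelIteratedLog.kernel_le_loglog_of_harmonicPartial` assumes the signed harmonic
partial sums bounded from EVERY base point at EVERY TRUNCATION, `|Σ_{r<x} δ_{K−1−r}∕(r+1)| ≤ C` for all `x ≤ K`; co-owner #3's road P3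
`RemainderExplicitSignedLetterIteratedLog` assumes only the FULL sums `|Σ_{i<K} δ_i∕(K − i)| ≤ H` (the exact letter of the representation,
their FILE E `reprBounded_iff_signedHarmonic`) and leaves «a bound on the truncated partial sums better than what §3 gives» NOT CLAIMED.
THIS FILE: THE TWO CURRENCIES ARE ONE.  The full-sum letter bounds every truncation with the constant 2, and 2 is sharp:
* `error_eq_fullSum_sub` — the errors from the full sums: `δ_i = e_i − Σ_{s<i} (u_{i−1−s} − u_{i−s})·e_s`, `e_s` the full sum at base
  point `s + 1`, `u` road P3's renewal sequence (their `errorSum_eq_renewal_conv` differenced);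
* `farSum_eq` — THE KEY IDENTITY: for `1 ≤ x ≤ K` the far part `Σ_{i<K−x} δ_i∕(K − i)` of the full sum at `K` is a combination
  `Σ_{s<K−x} C_s·e_s` of the earlier full sums with `C_s = Σ_{a<x} (u_{K−2−s−a} − u_{K−1−s−a})∕(a+1)` — road P3's difference identity
  `renewal_diff` read as «the full renewal convolution against `1∕m` VANISHES beyond lag one», so only the last `x` decrements survive;
* `coeff_nonneg`, `sum_coeff_le_one` — `C_s ≥ 0` (u antitone, their `renewal_succ_le`) and `Σ_{s<K−x} C_s = Σ_{a<x} (u_{x−1−a} −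
  u_{K−1−a})∕(a+1) ≤ 1` by the defining identity (R) of `u` at `x − 1` (telescoping in `s`);
* **`abs_truncatedHarmonic_le`**: `∀ K |Σ_{i<K} δ_i∕(K − i)| ≤ H ⟹ ∀ x ≤ K, |Σ_{K−x≤i<K} δ_i∕(K − i)| ≤ 2H`; backward form
  **`abs_truncatedHarmonic_back_le`** `|Σ_{r<x} δ_{K−1−r}∕(r+1)| ≤ 2H` — EXACTLY the OWNER's FILE 8 hypothesis `hC` with `C = 2H`
  (their `x = 1` case is road P3's `abs_error_le_of_signedHarmonic`, `|δ_n| ≤ 2H`);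
* **`two_sharp`**: for every `K ≥ 1` ONE δ with all full sums in `[−1, 1]` and `Σ_{K−1≤i<K} δ_i∕(K − i) = δ_{K−1} ≥ 2 − 1∕log(K+1)`
  (full sums `−1, …, −1, +1`; `δ_{K−1} = 2 − u_{K−1}` and road P3's `renewal_le_inv_log`) — no constant below 2 works.
CONSEQUENCE (by name, companion file `EriceRemainderEnclosureHarmonicTruncationJunction` once the OWNER's FILE 8 is in the tree): road
P3's END `kernel_le_loglog_of_signedHarmonic` (4H) and the OWNER's `kernel_le_loglog_of_harmonicPartial` (C + η with C = η = 2H)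
are the SAME bound; the bare-end letter lattice has ONE signed one-loop currency.
HONEST FRAMING (BETA-SPEC §0.2, verbatim and binding). *"Discharging BetaPertH makes Balaban's UV stability UNCONDITIONAL — a real
constructive-QFT result; it is NOT the continuum limit and NOT the Clay problem."*  THIS MODULE DISCHARGES NOTHING: elementary real analysis
with no β-function object in any statement; nothing of Balaban's (1.22) or of Balaban–Jaffe's β_n is asserted, constructed or
instantiated; row D4 class UNCHANGED (critical-path width 0: THE INSTANCE over NODE O.2 absent; instance 0∕1; D4 DISCHARGE NO DATE).
NOT [Balaban1987RG1] Theorem 2, NOT BetaPertH, NOT continuum, NOT Clay.  HONEST DEPENDENCY: continuum YM on T⁴ ⇐ BetaPertH ∧ nine spine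
estimates (0/9 proved); BetaPertH ⇐ (D1) ∧ (D4) ∧ CAP+tail; G-an2-4 gates asym, D1 and NE2/3/4.
-/

noncomputable section

open Finset Real

namespace Summit.QuantumFields.BalabanUV.Beta.EriceRemainderEnclosureHarmonicTruncation

open Summit.QuantumFields.BalabanUV.Beta.RemainderExplicitHarmonicRenewal
open Summit.QuantumFields.BalabanUV.Beta.RemainderExplicitSignedLetterIteratedLog (errorSum_eq_renewal_conv)

variable {u : ℕ → ℝ}

/-! ## §1 The errors from the full sums -/

/-- **THE ERRORS FROM THE FULL SUMS** (road P3's renewal representation, differenced): for ANY `u` with (R)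
`Σ_{a≤n} u_{n−a}∕(a+1) = 1` and ANY real δ, with `e_s = Σ_{i≤s} δ_i∕(s + 1 − i)` the full signed harmonic sum at base point `s + 1`:
`δ_i = e_i − Σ_{s<i} (u_{i−1−s} − u_{i−s})·e_s` (`u_0 = 1`). [folklore] -/
theorem error_eq_fullSum_sub (hu : ∀ n : ℕ, ∑ a ∈ range (n + 1), u (n - a) / ((a : ℝ) + 1) = 1)
    (δ : ℕ → ℝ) {e : ℕ → ℝ} (he : ∀ s : ℕ, e s = ∑ i ∈ range (s + 1), δ i / (((s + 1 : ℕ) : ℝ) - i)) (i : ℕ) :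
    δ i = e i - ∑ s ∈ range i, (u (i - 1 - s) - u (i - s)) * e s := by
  have h1 := errorSum_eq_renewal_conv hu δ he (i + 1)
  have h0 := errorSum_eq_renewal_conv hu δ he i
  simp only [sum_range_succ, Nat.add_sub_cancel, Nat.sub_self, renewal_zero hu, one_mul] at h1
  rw [h0] at h1
  have h2 : δ i = e i + ∑ s ∈ range i, u (i - s) * e s - ∑ s ∈ range i, u (i - 1 - s) * e s := by linarith
  rw [h2, add_sub_assoc, ← sum_sub_distrib, sub_eq_add_neg, ← sum_neg_distrib]
  congr 1
  exact sum_congr rfl fun s _ => by ring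

/-- A cast identity used throughout: for `i < K`, `((K − 1 − i : ℕ) : ℝ) + 1 = K − i`. -/
theorem cast_sub_one_sub {K i : ℕ} (h : i < K) : (((K - 1 - i : ℕ) : ℝ) + 1) = (K : ℝ) - i := by
  rw [Nat.sub_sub, Nat.cast_sub (by omega)]
  push_cast
  ring

/-! ## §2 The far part of a full sum is a combination of earlier full sums -/

/-- **THE KEY IDENTITY.**  For `1 ≤ x ≤ K` and any δ written through its full sums as in `error_eq_fullSum_sub`
(`δ_i = e_i − Σ_{s<i} (u_{i−1−s} − u_{i−s})·e_s`), the FAR part of the full sum at `K` is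
`Σ_{i<K−x} δ_i∕(K − i) = Σ_{s<K−x} C_s·e_s`, `C_s = Σ_{a<x} (u_{K−2−s−a} − u_{K−1−s−a})∕(a+1)`.
Proof: substitute, swap the double sum; the coefficient of `e_s` is `1∕(K−s) − Σ_{x≤a≤K−2−s} (u_{K−2−s−a} − u_{K−1−s−a})∕(a+1)`, and road
P3's difference identity `renewal_diff` at `n = K − 2 − s` says the FULL sum over `a ≤ K−2−s` equals `1∕(K−s)` — only the `x`
nearest decrements survive. [folklore] -/
theorem farSum_eq (hu : ∀ n : ℕ, ∑ a ∈ range (n + 1), u (n - a) / ((a : ℝ) + 1) = 1)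
    {δ e : ℕ → ℝ} (hδ : ∀ i : ℕ, δ i = e i - ∑ s ∈ range i, (u (i - 1 - s) - u (i - s)) * e s)
    {K x : ℕ} (hx1 : 1 ≤ x) (hxK : x ≤ K) :
    ∑ i ∈ range (K - x), δ i / ((K : ℝ) - i) =
      ∑ s ∈ range (K - x), (∑ a ∈ range x, (u (K - 2 - s - a) - u (K - 1 - s - a)) / ((a : ℝ) + 1)) * e s := by
  set J := K - x with hJ
  -- substitute the representation
  have step1 : ∑ i ∈ range J, δ i / ((K : ℝ) - i) =
      ∑ i ∈ range J, e i / ((K : ℝ) - i) -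
        ∑ i ∈ range J, ∑ s ∈ range i, (u (i - 1 - s) - u (i - s)) * e s / ((K : ℝ) - i) := by
    rw [← sum_sub_distrib]
    refine sum_congr rfl fun i _ => ?_
    rw [hδ i, sub_div, sum_div]
  -- swap the double sum: pairs s < i < J
  have step2 : ∑ i ∈ range J, ∑ s ∈ range i, (u (i - 1 - s) - u (i - s)) * e s / ((K : ℝ) - i) =
      ∑ s ∈ range J, e s * ∑ i ∈ Ico (s + 1) J, (u (i - 1 - s) - u (i - s)) / ((K : ℝ) - i) := by
    rw [sum_comm' (t' := range J) (s' := fun s => Ico (s + 1) J)]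
    · refine sum_congr rfl fun s _ => ?_
      rw [mul_sum]
      exact sum_congr rfl fun i _ => by ring
    · intro i s
      simp only [mem_range, mem_Ico]
      omega
  -- the inner sum, reflected to road P3's indexing `a = K − 1 − i`
  have step3 : ∀ s ∈ range J, ∑ i ∈ Ico (s + 1) J, (u (i - 1 - s) - u (i - s)) / ((K : ℝ) - i) =
      ∑ a ∈ Ico x (K - 1 - s), (u (K - 2 - s - a) - u (K - 1 - s - a)) / ((a : ℝ) + 1) := by
    intro s hs
    have hs' := mem_range.mp hs
    rw [sum_Ico_eq_sum_range, sum_Ico_eq_sum_range, show K - 1 - s - x = J - (s + 1) by omega,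
      ← sum_range_reflect]
    refine sum_congr rfl fun k hk => ?_
    have hk' := mem_range.mp hk
    have hc : ((K : ℝ) - ((s + 1 + (J - (s + 1) - 1 - k) : ℕ) : ℝ)) = ((x + k : ℕ) : ℝ) + 1 := by
      rw [show s + 1 + (J - (s + 1) - 1 - k) = K - (x + k + 1) by omega, Nat.cast_sub (by omega)]
      push_cast
      ring
    rw [hc, show s + 1 + (J - (s + 1) - 1 - k) - 1 - s = K - 2 - s - (x + k) by omega,
      show s + 1 + (J - (s + 1) - 1 - k) - s = K - 1 - s - (x + k) by omega]
  -- the difference identity: the full sum over `a ≤ K − 2 − s` is `1∕(K − s)`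
  have step4 : ∀ s ∈ range J, 1 / ((K : ℝ) - s) =
      ∑ a ∈ range (K - 1 - s), (u (K - 2 - s - a) - u (K - 1 - s - a)) / ((a : ℝ) + 1) := by
    intro s hs
    have hs' := mem_range.mp hs
    have h := renewal_diff hu (K - 2 - s)
    rw [show K - 2 - s + 1 = K - 1 - s by omega] at h
    have hc : ((K - 2 - s : ℕ) : ℝ) + 2 = (K : ℝ) - s := by
      rw [Nat.sub_sub, Nat.cast_sub (by omega)]; push_cast; ring
    rw [hc] at h
    exact h.symm
  -- assemble: coefficient of e_s = 1/(K−s) − inner = the x nearest decrements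
  rw [step1, step2]
  have step5 : ∑ i ∈ range J, e i / ((K : ℝ) - i) = ∑ s ∈ range J, e s * (1 / ((K : ℝ) - s)) :=
    sum_congr rfl fun s _ => by ring
  rw [step5, ← sum_sub_distrib]
  refine sum_congr rfl fun s hs => ?_
  have hs' := mem_range.mp hs
  rw [← mul_sub, step4 s hs, step3 s hs, mul_comm,
    ← sum_range_add_sum_Ico _ (show x ≤ K - 1 - s by omega), add_sub_cancel_right]

/-! ## §3 The coefficients are nonnegative and sum to at most one -/

/-- `C_s ≥ 0` for `s < K − x`: every decrement `u_{K−2−s−a} − u_{K−1−s−a}` (`a < x`) is nonnegative (road P3's `renewal_succ_le`). -/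
theorem coeff_nonneg (hu : ∀ n : ℕ, ∑ a ∈ range (n + 1), u (n - a) / ((a : ℝ) + 1) = 1) {K x s : ℕ}
    (hs : s < K - x) : 0 ≤ ∑ a ∈ range x, (u (K - 2 - s - a) - u (K - 1 - s - a)) / ((a : ℝ) + 1) := by
  refine sum_nonneg fun a ha => div_nonneg ?_ (by positivity)
  have ha' := mem_range.mp ha
  rw [show K - 1 - s - a = (K - 2 - s - a) + 1 by omega]
  linarith [renewal_succ_le hu (K - 2 - s - a)]

/-- **`Σ_{s<K−x} C_s = Σ_{a<x} (u_{x−1−a} − u_{K−1−a})∕(a+1) ≤ 1`** (telescoping in `s`, then (R) at `x − 1` and `u ≥ 0`). [folklore] -/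
theorem sum_coeff_le_one (hu : ∀ n : ℕ, ∑ a ∈ range (n + 1), u (n - a) / ((a : ℝ) + 1) = 1) {K x : ℕ}
    (hx1 : 1 ≤ x) (hxK : x ≤ K) :
    ∑ s ∈ range (K - x), ∑ a ∈ range x, (u (K - 2 - s - a) - u (K - 1 - s - a)) / ((a : ℝ) + 1) ≤ 1 := by
  rw [sum_comm]
  have htel : ∀ a ∈ range x, ∑ s ∈ range (K - x), (u (K - 2 - s - a) - u (K - 1 - s - a)) / ((a : ℝ) + 1) =
      (u (x - 1 - a) - u (K - 1 - a)) / ((a : ℝ) + 1) := by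
    intro a ha
    have ha' := mem_range.mp ha
    rw [← sum_div]
    congr 1
    have h := sum_range_sub (fun s => u (K - 1 - a - s)) (K - x)
    simp only [Nat.sub_zero] at h
    rw [show K - 1 - a - (K - x) = x - 1 - a by omega] at h
    rw [← h]
    refine sum_congr rfl fun s hs => ?_
    rw [show K - 1 - a - (s + 1) = K - 2 - s - a by omega, show K - 1 - a - s = K - 1 - s - a by omega]
  rw [sum_congr rfl htel]
  have hR := hu (x - 1)
  rw [show x - 1 + 1 = x by omega] at hR
  have hnn : 0 ≤ ∑ a ∈ range x, u (K - 1 - a) / ((a : ℝ) + 1) :=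
    sum_nonneg fun a _ => div_nonneg (renewal_nonneg hu _) (by positivity)
  calc ∑ a ∈ range x, (u (x - 1 - a) - u (K - 1 - a)) / ((a : ℝ) + 1)
      = ∑ a ∈ range x, u (x - 1 - a) / ((a : ℝ) + 1) - ∑ a ∈ range x, u (K - 1 - a) / ((a : ℝ) + 1) := by
        rw [← sum_sub_distrib]; exact sum_congr rfl fun a _ => by ring
    _ ≤ 1 := by rw [hR]; linarith

/-! ## §4 THE FULL-SUM LETTER BOUNDS ALL ITS TRUNCATIONS -/

/-- **ONE CURRENCY (forward form).**  If the FULL signed harmonic sums are bounded, `|Σ_{i<K} δ_i∕(K − i)| ≤ H` for every `K`, then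
EVERY truncation is bounded with the constant 2: `|Σ_{K−x≤i<K} δ_i∕(K − i)| ≤ 2H` for all `x ≤ K`.
Proof: truncated = full − far; by `farSum_eq` the far part is `Σ_{s<K−x} C_s e_s` with `C_s ≥ 0`, `Σ C_s ≤ 1`, `|e_s| ≤ H`, so
`|far| ≤ H`.  No a-priori bound on δ is assumed.  (The `x = 1` case is road P3's `abs_error_le_of_signedHarmonic`.) [folklore] -/
theorem abs_truncatedHarmonic_le {δ : ℕ → ℝ} {H : ℝ}
    (hH : ∀ K : ℕ, |∑ i ∈ range K, δ i / ((K : ℝ) - i)| ≤ H) {K x : ℕ} (hxK : x ≤ K) :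
    |∑ i ∈ Ico (K - x) K, δ i / ((K : ℝ) - i)| ≤ 2 * H := by
  have hH0 : 0 ≤ H := le_trans (abs_nonneg _) (hH 0)
  rcases Nat.eq_zero_or_pos x with hx0 | hx1
  · subst hx0
    simp only [Nat.sub_zero, Ico_self, sum_empty, abs_zero]
    linarith
  obtain ⟨u, hu⟩ := renewal_exists
  set e : ℕ → ℝ := fun s => ∑ i ∈ range (s + 1), δ i / (((s + 1 : ℕ) : ℝ) - i) with hedef
  have he : ∀ s, |e s| ≤ H := fun s => hH (s + 1)
  have hδ : ∀ i, δ i = e i - ∑ s ∈ range i, (u (i - 1 - s) - u (i - s)) * e s :=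
    error_eq_fullSum_sub hu δ (e := e) (fun s => rfl)
  have hfar := farSum_eq hu hδ hx1 hxK
  have hsplit := sum_range_add_sum_Ico (fun i => δ i / ((K : ℝ) - i)) (Nat.sub_le K x)
  have htr : ∑ i ∈ Ico (K - x) K, δ i / ((K : ℝ) - i) =
      ∑ i ∈ range K, δ i / ((K : ℝ) - i) - ∑ i ∈ range (K - x), δ i / ((K : ℝ) - i) := by linarith
  have hfar_le : |∑ i ∈ range (K - x), δ i / ((K : ℝ) - i)| ≤ H := by
    rw [hfar]
    calc |∑ s ∈ range (K - x), (∑ a ∈ range x, (u (K - 2 - s - a) - u (K - 1 - s - a)) / ((a : ℝ) + 1)) * e s|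
        ≤ ∑ s ∈ range (K - x), |(∑ a ∈ range x, (u (K - 2 - s - a) - u (K - 1 - s - a)) / ((a : ℝ) + 1)) * e s| :=
          abs_sum_le_sum_abs _ _
      _ ≤ ∑ s ∈ range (K - x), (∑ a ∈ range x, (u (K - 2 - s - a) - u (K - 1 - s - a)) / ((a : ℝ) + 1)) * H := by
          refine sum_le_sum fun s hs => ?_
          have hC := coeff_nonneg hu (mem_range.mp hs)
          rw [abs_mul, abs_of_nonneg hC]
          exact mul_le_mul_of_nonneg_left (he s) hC
      _ = (∑ s ∈ range (K - x), ∑ a ∈ range x, (u (K - 2 - s - a) - u (K - 1 - s - a)) / ((a : ℝ) + 1)) * H := by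
          rw [sum_mul]
      _ ≤ 1 * H := mul_le_mul_of_nonneg_right (sum_coeff_le_one hu hx1 hxK) hH0
      _ = H := one_mul H
  rw [htr]
  calc |∑ i ∈ range K, δ i / ((K : ℝ) - i) - ∑ i ∈ range (K - x), δ i / ((K : ℝ) - i)|
      ≤ |∑ i ∈ range K, δ i / ((K : ℝ) - i)| + |∑ i ∈ range (K - x), δ i / ((K : ℝ) - i)| := abs_sub _ _
    _ ≤ H + H := add_le_add (hH K) hfar_le
    _ = 2 * H := by ring

/-- **ONE CURRENCY (backward form — the OWNER's FILE 8 hypothesis).**  Under the full-sum letter, the backward harmonic partial sums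
from every base point at every truncation obey `|Σ_{r<x} δ_{K−1−r}∕(r+1)| ≤ 2H` (`x ≤ K`) — literally the hypothesis `hC` of
`RemainderCouplingKernelIteratedLog.kernel_le_loglog_of_harmonicPartial` with `C = 2H`. [folklore] -/
theorem abs_truncatedHarmonic_back_le {δ : ℕ → ℝ} {H : ℝ}
    (hH : ∀ K : ℕ, |∑ i ∈ range K, δ i / ((K : ℝ) - i)| ≤ H) (K x : ℕ) (hxK : x ≤ K) :
    |∑ r ∈ range x, δ (K - 1 - r) / ((r : ℝ) + 1)| ≤ 2 * H := by
  have h := abs_truncatedHarmonic_le hH hxK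
  have e1 : ∑ i ∈ Ico (K - x) K, δ i / ((K : ℝ) - i) = ∑ r ∈ range x, δ (K - 1 - r) / ((r : ℝ) + 1) := by
    rw [sum_Ico_eq_sum_range, show K - (K - x) = x by omega, ← sum_range_reflect]
    refine sum_congr rfl fun r hr => ?_
    have hr' := mem_range.mp hr
    rw [show K - x + (x - 1 - r) = K - 1 - r by omega, ← cast_sub_one_sub (show K - 1 - r < K by omega),
      show K - 1 - (K - 1 - r) = r by omega]
  rw [e1] at h
  exact h

/-! ## §5 The constant 2 is sharp -/

/-- **SHARPNESS.**  For every `K ≥ 1` there is ONE real sequence δ all of whose full signed harmonic sums lie in `[−1, 1]` and whose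
last truncation `Σ_{K−1≤i<K} δ_i∕(K − i) = δ_{K−1}` is at least `2 − 1∕log(K + 1)`: prescribe the full sums `e = (−1, …, −1, +1)` and
read δ off `error_eq_fullSum_sub`; then `δ_{K−1} = 1 + (u_0 − u_{K−1}) = 2 − u_{K−1}` and road P3's `renewal_le_inv_log`.  So no constant
below 2 serves in `abs_truncatedHarmonic_le`. [folklore] -/
theorem two_sharp (K : ℕ) (hK : 1 ≤ K) : ∃ δ : ℕ → ℝ,
    (∀ t : ℕ, |∑ i ∈ range t, δ i / ((t : ℝ) - i)| ≤ 1) ∧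
    2 - 1 / Real.log ((K : ℝ) + 1) ≤ ∑ i ∈ Ico (K - 1) K, δ i / ((K : ℝ) - i) := by
  obtain ⟨u, hu⟩ := renewal_exists
  -- prescribed full sums
  let e : ℕ → ℝ := fun s => if s + 1 < K then -1 else 1
  have he1 : ∀ s, |e s| ≤ 1 := by
    intro s; simp only [e]; split_ifs <;> simp
  -- the errors read off the representation
  let δ : ℕ → ℝ := fun i => e i - ∑ s ∈ range i, (u (i - 1 - s) - u (i - s)) * e s
  have hδ : ∀ i, δ i = e i - ∑ s ∈ range i, (u (i - 1 - s) - u (i - s)) * e s := fun i => rfl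
  -- the actual full sums of δ coincide with e (strong induction through `error_eq_fullSum_sub`)
  set e' : ℕ → ℝ := fun s => ∑ i ∈ range (s + 1), δ i / (((s + 1 : ℕ) : ℝ) - i) with he'def
  have hδ' : ∀ i, δ i = e' i - ∑ s ∈ range i, (u (i - 1 - s) - u (i - s)) * e' s :=
    error_eq_fullSum_sub hu δ (e := e') (fun s => rfl)
  have hee : ∀ s, e' s = e s := by
    intro s
    induction s using Nat.strong_induction_on with
    | _ s ih =>
      have h1 := hδ s
      have h2 := hδ' s
      have h3 : ∑ t ∈ range s, (u (s - 1 - t) - u (s - t)) * e' t = ∑ t ∈ range s, (u (s - 1 - t) - u (s - t)) * e t :=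
        sum_congr rfl fun t ht => by rw [ih t (mem_range.mp ht)]
      linarith
  refine ⟨δ, fun t => ?_, ?_⟩
  · rcases Nat.eq_zero_or_pos t with ht0 | ht1
    · subst ht0; simp
    · have h := hee (t - 1)
      simp only [he'def] at h
      rw [show t - 1 + 1 = t by omega] at h
      rw [h]
      exact he1 _
  · -- the last truncation is δ_{K−1} = 2 − u_{K−1}
    have hlast : ∑ i ∈ Ico (K - 1) K, δ i / ((K : ℝ) - i) = δ (K - 1) := by
      rw [show K = (K - 1) + 1 from (Nat.sub_add_cancel hK).symm, Nat.add_sub_cancel, Nat.Ico_succ_singleton, sum_singleton]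
      have hc : (((K - 1 + 1 : ℕ) : ℝ) - ((K - 1 : ℕ) : ℝ)) = 1 := by push_cast; ring
      rw [hc, div_one]
    have hval : δ (K - 1) = 2 - u (K - 1) := by
      rw [hδ]
      have heK : e (K - 1) = 1 := by simp only [e]; rw [if_neg (by omega)]
      have hes : ∀ s ∈ range (K - 1), e s = -1 := by
        intro s hs; have hs' := mem_range.mp hs; simp only [e]; rw [if_pos (by omega)]
      rw [heK, sum_congr rfl fun s hs => by rw [hes s hs]]
      have htel : ∑ s ∈ range (K - 1), (u (K - 1 - 1 - s) - u (K - 1 - s)) * (-1 : ℝ) = u (K - 1) - u 0 := by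
        have h := sum_range_sub' (fun s => u (K - 1 - s)) (K - 1)
        simp only [Nat.sub_zero, Nat.sub_self] at h
        rw [← h]
        refine sum_congr rfl fun s hs => ?_
        rw [show K - 1 - (s + 1) = K - 1 - 1 - s by omega]
        ring
      rw [htel, renewal_zero hu]
      ring
    rw [hlast, hval]
    have hlog := renewal_le_inv_log hu (K - 1)
    have hc : ((K - 1 : ℕ) : ℝ) + 2 = (K : ℝ) + 1 := by rw [Nat.cast_sub hK]; push_cast; ring
    rw [hc] at hlog
    linarith

/-- **END — `harmonicTruncation_census` (row D4 co-owner #2, generation 31).**  Packaged: (i) under the full-sum letter every backward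
truncated harmonic sum is ≤ 2H (the OWNER's all-truncations currency FROM road P3's full-sum currency; the converse is the case `x = K`);
(ii) the constant 2 is attained up to `1∕log(K+1)`.  Row D4 class UNCHANGED; nothing of Balaban's; NOT B12 Thm 2, NOT BetaPertH,
NOT continuum, NOT Clay. [folklore] -/
theorem harmonicTruncation_census :
    (∀ (δ : ℕ → ℝ) (H : ℝ), (∀ K : ℕ, |∑ i ∈ range K, δ i / ((K : ℝ) - i)| ≤ H) →
      ∀ K x : ℕ, x ≤ K → |∑ r ∈ range x, δ (K - 1 - r) / ((r : ℝ) + 1)| ≤ 2 * H) ∧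
    (∀ K : ℕ, 1 ≤ K → ∃ δ : ℕ → ℝ, (∀ t : ℕ, |∑ i ∈ range t, δ i / ((t : ℝ) - i)| ≤ 1) ∧
      2 - 1 / Real.log ((K : ℝ) + 1) ≤ ∑ i ∈ Ico (K - 1) K, δ i / ((K : ℝ) - i)) :=
  ⟨fun _ _ hH K x hx => abs_truncatedHarmonic_back_le hH K x hx, fun K hK => two_sharp K hK⟩

end Summit.QuantumFields.BalabanUV.Beta.EriceRemainderEnclosureHarmonicTruncation

end
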